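import Summits.AtomisticToContinuum.FouriersLaw.Theorems.BondHeatUncertaintyBoundedResponseStorageLeak
import Summits.AtomisticToContinuum.FouriersLaw.Theorems.BondHeatUncertaintySubdiffusiveBondHeatKineticCorrectorBudget
import HarnessLib

/-!
# BondHeatUncertainty / BoundedResponse — the KCB hanger: `KineticCorrectorBudget` ⟹ (C₁) `CorrectorGrade 1`

Decomposition node `decomp-a2c-lens-1 / g95` (grading lens), addendum to GEN 95E «StorageLeak» (critic row 1351 (i)):
the (C₁) leg `CorrectorGrade 1` (`‖h₀‖²_{μ_T} ≤ C·N`, `h₀ = R₀(p₀² − T)` the Kubo corrector) of DOOR v6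
`BoundedResponse ⟸ LeakPoint ∧ CorrectorGrade 1 ∧ EnergyFluctuationExtensive` is the `τ = ∞` rung of GEN 53K's
kinetic-corrector budget `KineticCorrectorBudget` (`…SubdiffusiveBondHeat.CorrectorBudget`, `∀ τ ≥ 0, ‖∫₀^τ P_uθ₀ du‖² ≤ C·N`):
`h₀ = lim_τ ∫_(0,τ] P_uθ₀ du` pointwise (absolute convergence of the Kubo integral under the Harris package) and dominated
convergence in `L²(μ_T)` (dominant `(K(2/ϑ+T)/c)² e^{2ϑH}`, `ϑ = 1/(4T)`).  Seams: `correctorGrade_one_of_kineticCorrectorBudget :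
KineticCorrectorBudget → CorrectorGrade 1` (same constants) and the by-name door
`boundedResponse_of_leakPoint_energyFluct_kcb : LeakPoint → EnergyFluctuationExtensive → KineticCorrectorBudget → BoundedResponse`.
No item is closed here; 0 sorry, standard axioms.

References: [cite: CuneoEckmannHairerReyBellet2018, Thm 2.13] (Harris package), [cite: KunduDharNarayan2009] (Green–Kubo for the chain).
-/

noncomputable section

open MeasureTheory ProbabilityTheory Filter Topology Set Function
open scoped NNReal ENNReal ContDiff
open Literature.MathematicalPhysics.KineticTheory.HeatConduction
open Literature.MathematicalPhysics.KineticTheory OscillatorChain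
open Summit.AtomisticToContinuum.FouriersLaw.Theorems.SubdiffusiveBondHeat
open Summit.AtomisticToContinuum.FouriersLaw.Theorems.OddSectorIrreversibility
open Summit.AtomisticToContinuum.FouriersLaw.Theorems.ExtensiveSnapshotIrreversibility.ClausiusBudget
open Summit.AtomisticToContinuum.FouriersLaw.Theorems.HonestZwanzig
open Summit.AtomisticToContinuum.FouriersLaw.Theorems.BoundedResponse.TransientBand
open Summit.AtomisticToContinuum.FouriersLaw.Cruxes.SuperadditiveResistance.FloatingProbeBypassLaplacian

namespace Summit.AtomisticToContinuum.FouriersLaw.Theorems.BoundedResponse.ParityFloor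

open Summit.AtomisticToContinuum.FouriersLaw.Theses.BondHeatUncertainty (BoundedResponse ExtensiveSnapshotIrreversibility)
open Summit.AtomisticToContinuum.FouriersLaw.Theorems.SubdiffusiveBondHeat.EscapeGrading (OhmicFloor ExponentFloor)
open Summit.AtomisticToContinuum.FouriersLaw.Theorems.BoundedResponse.TransientBand
  (DeficitCesaroPoint TransientFloor TransientCeilingPoint DeficitCesaroGrade)

/-! ## §H The KCB hanger: `KineticCorrectorBudget` (GEN 53K) ⟹ (C₁) `CorrectorGrade 1` -/

section Hanger

open Summit.AtomisticToContinuum.FouriersLaw.Theorems.SubdiffusiveBondHeat.CorrectorBudget (KineticCorrectorBudget)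

variable {ω₂ lam β γ T : ℝ} {N : ℕ}

/-- **Pointwise bound on the finite-horizon Kubo integrals**: `|∫_(0,τ] v_s(z) ds| ≤ (K(2/ϑ+T)/c)·e^{ϑH(z)}`
(the Harris decay `|v_s| ≤ K(2/ϑ+T)e^{ϑH}e^{−cs}` integrated over `(0,τ] ⊆ (0,∞)`, `∫_(0,∞) e^{−cs} ds = 1/c`). [folklore] -/
theorem abs_setIntegral_kinAct_le (hω : 0 < ω₂) (hl : 0 ≤ lam) (hβ : 0 < β) (hγ : 0 < γ) (hT : 0 < T)
    {ϑ K c : ℝ} (hϑ0 : 0 < ϑ)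
    (hb : ∀ (z : PhaseSpace N) (t : ℝ≥0) (f : PhaseSpace N → ℝ), Continuous f → ∀ C : ℝ, 0 ≤ C →
      (∀ y, |f y| ≤ C * Real.exp (ϑ * (pinnedChain ω₂ lam β γ).hamiltonian N y)) →
      |(∫ y, f y ∂((pinnedChain ω₂ lam β γ).transitionKernel N T T t z)) -
          ∫ y, f y ∂((pinnedChain ω₂ lam β γ).gibbsMeasure N T)| ≤
        K * C * Real.exp (ϑ * (pinnedChain ω₂ lam β γ).hamiltonian N z) * Real.exp (-c * t)) (hc : 0 < c)
    (b : Fin N) (z : PhaseSpace N) (τ : ℝ) :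
    |∫ s in Ioc (0 : ℝ) τ, kinAct ω₂ lam β γ T N b s z| ≤
      K * (2 / ϑ + T) / c * Real.exp (ϑ * (pinnedChain ω₂ lam β γ).hamiltonian N z) := by
  set E := Real.exp (ϑ * (pinnedChain ω₂ lam β γ).hamiltonian N z) with hE
  obtain ⟨-, hpt⟩ := kinAct_integrableOn hω hl hβ hγ hT hϑ0 hb hc b z
  have hdecay : IntegrableOn (fun t : ℝ => K * (2 / ϑ + T) * E * Real.exp (-c * t)) (Ioi 0) :=
    (exp_neg_integrableOn_Ioi 0 hc).const_mul _
  have hbd : ∀ᵐ t ∂(volume.restrict (Ioc (0 : ℝ) τ)), ‖kinAct ω₂ lam β γ T N b t z‖ ≤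
      K * (2 / ϑ + T) * E * Real.exp (-c * t) :=
    (ae_restrict_iff' measurableSet_Ioc).2 (Eventually.of_forall fun t ht => by
      rw [Real.norm_eq_abs]; exact hpt t ht.1.le)
  have h := norm_integral_le_of_norm_le (hdecay.mono_set Ioc_subset_Ioi_self) hbd
  rw [← Real.norm_eq_abs]
  refine h.trans ?_
  have hnn : ∀ t : ℝ, 0 ≤ K * (2 / ϑ + T) * E * Real.exp (-c * t) := fun t => by
    have h0 := (abs_nonneg _).trans (hpt 0 le_rfl)
    rw [mul_zero, Real.exp_zero, mul_one] at h0
    exact mul_nonneg h0 (Real.exp_pos _).le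
  have hmono : ∫ t in Ioc (0 : ℝ) τ, K * (2 / ϑ + T) * E * Real.exp (-c * t) ≤
      ∫ t in Ioi (0 : ℝ), K * (2 / ϑ + T) * E * Real.exp (-c * t) :=
    setIntegral_mono_set hdecay (Eventually.of_forall hnn) (Eventually.of_forall Ioc_subset_Ioi_self)
  refine hmono.trans_eq ?_
  rw [integral_const_mul, integral_exp_neg_mul_Ioi' hc]
  ring

/-- **KCB hanger** (critic row 1351 (i)): the kinetic-corrector budget `KineticCorrectorBudget` of GEN 53K
(`∃ C N₀ ∀ N ≥ N₀ ∀ τ ≥ 0, ‖∫₀^τ P_uθ₀ du‖²_{μ_T} ≤ C·N`) implies (C₁) `CorrectorGrade 1` (`‖h₀‖²_{μ_T} ≤ C·N` for `N ≥ N₀`)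
with the SAME constants: `h₀(z) = lim_{n→∞} ∫_(0,n] v_s(z) ds` for every `z` (absolute convergence of the Kubo integral,
`pinnedChain_tendsto_kubo`) and dominated convergence in `L²(μ_T)` with the dominant `(K(2/ϑ+T)/c)²e^{2ϑH} ∈ L¹(μ_T)`,
`ϑ = 1/(4T)`.  So (C₁) is the `τ = ∞` rung of the KCB ladder, not a new leaf. [folklore] -/
theorem correctorGrade_one_of_kineticCorrectorBudget : KineticCorrectorBudget → CorrectorGrade 1 := by
  intro hKCB ω₂ lam β γ hω hl hβ hγ T hT
  obtain ⟨C, N₀, hC⟩ := hKCB ω₂ lam β γ hω hl hβ hγ T hT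
  refine ⟨C, N₀, fun N hN hN₀ => ?_⟩
  set P := pinnedChain ω₂ lam β γ with hP
  haveI : IsProbabilityMeasure (P.gibbsMeasure N T) :=
    pinnedChain_isProbabilityMeasure_gibbsMeasure hω hl.le hβ.le γ N hT
  obtain ⟨hϑ0, h2ϑ, hϑ1⟩ := weight_facts hT
  obtain ⟨K, c, hK, hc, hb⟩ := harrisBound_exists hω hl.le hβ hγ hN hT hϑ0 hϑ1
  -- KCB at the integer horizons `τ = n`
  have hKn : ∀ n : ℕ, ∫ z, (∫ u in Ioc (0 : ℝ) (n : ℝ), kinAct ω₂ lam β γ T N ⟨0, hN⟩ u z) ^ 2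
      ∂(P.gibbsMeasure N T) ≤ C * (N : ℝ) := fun n => by
    have h := hC N hN₀ (n : ℝ) (Nat.cast_nonneg n)
    rw [dif_pos hN] at h
    simpa only [kinAct, kinObs, intervalIntegral.integral_of_le (Nat.cast_nonneg n)] using h
  -- pointwise convergence of the finite-horizon Kubo integrals to `h₀`
  have hlim : ∀ z, Tendsto (fun n : ℕ => (∫ u in Ioc (0 : ℝ) (n : ℝ), kinAct ω₂ lam β γ T N ⟨0, hN⟩ u z) ^ 2)
      atTop (𝓝 (kinCorrector ω₂ lam β γ T N ⟨0, hN⟩ z ^ 2)) := fun z => by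
    have h1 := pinnedChain_tendsto_kubo hω hl.le hβ hγ hb hc (continuous_kinObs T ⟨0, hN⟩) (by positivity)
      (fun y => abs_kinObs_le hω hl.le hβ.le hT.le hϑ0 ⟨0, hN⟩ y) (integral_kinObs hω hl.le hβ.le hT ⟨0, hN⟩) z
    have h3 := (h1.comp tendsto_natCast_atTop_atTop).pow 2
    refine h3.congr fun n => ?_
    simp only [Function.comp_apply, kinAct]
  -- measurability
  have hgm : ∀ n : ℕ, AEStronglyMeasurable
      (fun z => (∫ u in Ioc (0 : ℝ) (n : ℝ), kinAct ω₂ lam β γ T N ⟨0, hN⟩ u z) ^ 2) (P.gibbsMeasure N T) :=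
    fun n => by
    obtain ⟨-, hDs, hD2, -⟩ := increment_facts hω hl.le hβ hγ hN hT ⟨0, hN⟩ (Nat.cast_nonneg n)
    have e : (fun z => (∫ u in Ioc (0 : ℝ) (n : ℝ), kinAct ω₂ lam β γ T N ⟨0, hN⟩ u z) ^ 2) =
        fun z => (kinCorrector ω₂ lam β γ T N ⟨0, hN⟩ z - corrAct ω₂ lam β γ T N ⟨0, hN⟩ (n : ℝ) z) ^ 2 := by
      funext z
      rw [hDs z]
    rw [e]
    exact hD2.aestronglyMeasurable
  -- the dominant `D² e^{2ϑH}`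
  set D : ℝ := K * (2 / (1 / (4 * T)) + T) / c with hD
  have hν : Integrable (fun y => Real.exp (2 * (1 / (4 * T)) * P.hamiltonian N y)) (P.gibbsMeasure N T) :=
    pinnedChain_integrable_exp_mul_hamiltonian_gibbsMeasure hω hl.le hβ.le γ N hT h2ϑ
  have hdom : ∀ n : ℕ, ∀ᵐ z ∂(P.gibbsMeasure N T),
      ‖(∫ u in Ioc (0 : ℝ) (n : ℝ), kinAct ω₂ lam β γ T N ⟨0, hN⟩ u z) ^ 2‖ ≤
        D ^ 2 * Real.exp (2 * (1 / (4 * T)) * P.hamiltonian N z) := fun n =>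
    Eventually.of_forall fun z => by
      have hR := abs_setIntegral_kinAct_le hω hl.le hβ hγ hT hϑ0 hb hc ⟨0, hN⟩ z (n : ℝ)
      rw [Real.norm_eq_abs, abs_pow]
      calc |∫ u in Ioc (0 : ℝ) (n : ℝ), kinAct ω₂ lam β γ T N ⟨0, hN⟩ u z| ^ 2
          ≤ (D * Real.exp (1 / (4 * T) * P.hamiltonian N z)) ^ 2 := pow_le_pow_left₀ (abs_nonneg _) hR 2
        _ = D ^ 2 * Real.exp (2 * (1 / (4 * T)) * P.hamiltonian N z) := by
          rw [mul_pow, sq (Real.exp _), ← Real.exp_add]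
          congr 2
          ring
  have hDCT := tendsto_integral_of_dominated_convergence
    (fun z => D ^ 2 * Real.exp (2 * (1 / (4 * T)) * P.hamiltonian N z)) hgm (hν.const_mul _) hdom
    (Eventually.of_forall hlim)
  rw [Real.rpow_one]
  exact le_of_tendsto' hDCT hKn

/-- **DOOR v6 on the KCB ladder**: `BoundedResponse` (stmt-11071) ⟸ (D_F) `LeakPoint` ∧ (V) `EnergyFluctuationExtensive` ∧
KCB `KineticCorrectorBudget` — DOOR v6 (`boundedResponse_of_leakPoint_grades`) with its (C₁) leg hung on GEN 53K's corrector budget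
(`correctorGrade_one_of_kineticCorrectorBudget`).  (DOOR v6 itself is the weaker-hypothesis form, since (C₁) ⟸ KCB.) [folklore] -/
theorem boundedResponse_of_leakPoint_energyFluct_kcb :
    LeakPoint → EnergyFluctuationExtensive → KineticCorrectorBudget → BoundedResponse := fun hF hV hK =>
  boundedResponse_of_leakPoint_grades hF hV (correctorGrade_one_of_kineticCorrectorBudget hK)

end Hanger

end Summit.AtomisticToContinuum.FouriersLaw.Theorems.BoundedResponse.ParityFloor

end
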